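import Literature.IUT.LogThetaLattice.HolomorphicLogShellUnramified
import HarnessLib

/-!
# IUT REPAIR BRANCH (rung LADDER-ABC:A2.RP), class (i) INTERNAL, sub-cell B0, seat rp-d2 — `CandInternal2Real`: the content of row RP-I06
# («the q-pilot's Kummer datum lies in the log-shell orbit of the Θ-pilot's: `q_v ∈ q_v^{j²}·𝓘_v`») AT THE REAL `p`-ADIC LOG-SHELL of the
# tree — FALSE at every absolutely unramified odd place for every label `j ≥ 2`, and in general a HEIGHT BOUND by the log-shell's radius

Proof-only file (D-0012; no definition, no `Prop` fact) of the abc-iut cell, IUT REPAIR branch (REPAIR-SPEC v0.4; class reading of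
HOME/plan/repair/d2/D2-CENSUS.md). TAKES NO SIDE on [IUTchIII] Cor. 3.12 or on any author; classical local-field arithmetic about the
log-shell `ℐ_K = (p*)⁻¹·log_p(𝒪_K^×)` of [AbsTopIII] Def. 5.4 (iii) (abc-iut-L4-t3's `PadicLogOnUnits.logShell`, abc-iut-S1's real logarithm
`PadicLogOnUnits.ofUnitLog`), supporting the T-d/T-c reading of the toy rows RP-I06/I06b/I06c/I18 (`Repair.CandInternal2`, `…14`): on the toy
log-shell family the rows hold iff `3 ≤ d` («3 × height ≤ log-shell inflation»); here the same inequality is proved for the REAL shell.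

RESULTS. §1 (any normed field) `norm_le_of_mem_pow_smul : q ∈ q^n • I → I ⊆ closedBall 0 R → ‖q‖ ≤ ‖q‖^n · R` (the HEIGHT BOUND: with
`‖q‖ = p^{−h}`, `R = p^{c}` it reads `(n − 1)·h ≤ c`); `not_mem_pow_smul_of_subset_closedBall_one : I ⊆ 𝒪_K → 0 < ‖q‖ < 1 → 2 ≤ n → q ∉ q^n • I`.
§2 (the real log-shell) **`not_mem_pow_smul_logShell_of_unramified`: for `K/ℚ_p` with `e = 1`, `p ≠ 2` (so `ℐ_K = 𝒪_K`, abc-iut-L6's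
`logShell_ofUnitLog_eq_closedBall_of_unramified`), every `q ∈ 𝔪_K ∖ {0}` and every `n ≥ 2`: `q ∉ q^n · ℐ_K`** — in particular (`n = j²`,
`j ≥ 2`) the content of RP-I06 fails at every absolutely unramified odd place of the intended arithmetic for every q-parameter (a non-unit),
consistent with print's own bookkeeping that value-group portions are not subject to (Ind3) ([IUTchIII] Rmk. 3.11.1 (viii) p. 166
l. 16–30) and with RP-I06's grade NOT-IN-PRINT-as-premise. [claim: Mochizuki2012, status: disputed] [cite: MochizukiAbsTopIII2015, Def 5.4 (iii) p. 126]
-/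

noncomputable section

namespace Summit.ABC.IUTFork.Repair.CandInternal2Real

open Set Metric
open scoped Pointwise
open Literature.AnabelianGeometry.AbsoluteAnabelian Literature.IUT.LogThetaLattice Literature.IUT.LogVolume

/-! ## 1. The height bound in any normed field -/

section NormedField

variable {K : Type*} [NormedField K]

/-- **HEIGHT BOUND.** If `q ∈ q^n · I` with `I` inside the ball of radius `R`, then `‖q‖ ≤ ‖q‖^n · R` — i.e. with `‖q‖ = p^{−h}` and `R = p^{c}`:
`(n − 1)·h ≤ c` («(j² − 1) × local height ≤ log-shell index» for `n = j²`). [folklore] -/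
theorem norm_le_of_mem_pow_smul {q : K} {n : ℕ} {I : Set K} {R : ℝ} (hI : I ⊆ closedBall (0 : K) R) (h : q ∈ q ^ n • I) :
    ‖q‖ ≤ ‖q‖ ^ n * R := by
  obtain ⟨ι, hι, hq⟩ := Set.mem_smul_set.1 h
  have hιR : ‖ι‖ ≤ R := by simpa [mem_closedBall, dist_zero_right] using hI hι
  have hnorm : ‖q‖ = ‖q‖ ^ n * ‖ι‖ := by
    conv_lhs => rw [← hq]
    rw [smul_eq_mul, norm_mul, norm_pow]
  calc ‖q‖ = ‖q‖ ^ n * ‖ι‖ := hnorm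
    _ ≤ ‖q‖ ^ n * R := mul_le_mul_of_nonneg_left hιR (pow_nonneg (norm_nonneg q) n)

/-- With `I ⊆ 𝒪_K` (radius `1`), a nonzero TOPOLOGICALLY NILPOTENT `q` (`‖q‖ < 1`) is never in `q^n · I` for `n ≥ 2`. [folklore] -/
theorem not_mem_pow_smul_of_subset_closedBall_one {q : K} {n : ℕ} {I : Set K} (hI : I ⊆ closedBall (0 : K) 1) (hq0 : q ≠ 0)
    (hq1 : ‖q‖ < 1) (hn : 2 ≤ n) : q ∉ q ^ n • I := fun h => by
  have hle := norm_le_of_mem_pow_smul hI h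
  rw [mul_one] at hle
  have hpos : 0 < ‖q‖ := norm_pos_iff.2 hq0
  have hlt : ‖q‖ ^ n < ‖q‖ := by
    calc ‖q‖ ^ n ≤ ‖q‖ ^ 2 := pow_le_pow_of_le_one hpos.le hq1.le hn
      _ = ‖q‖ * ‖q‖ := pow_two _
      _ < ‖q‖ * 1 := (mul_lt_mul_of_pos_left hq1 hpos)
      _ = ‖q‖ := mul_one _
  exact absurd hle (not_le.2 hlt)

end NormedField

/-! ## 2. At the real log-shell of an absolutely unramified odd place -/

section Unramified

variable (p : ℕ) [Fact p.Prime]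
variable (K : Type*) [NontriviallyNormedField K] [NormedAlgebra ℚ_[p] K] [IsUltrametricDist K] [ProperSpace K]

/-- **RP-I06's content at the REAL log-shell, absolutely unramified odd place: FALSE.** For `K/ℚ_p` with `e = 1` and `p ≠ 2` the log-shell is
`𝒪_K` (abc-iut-L6 `logShell_ofUnitLog_eq_closedBall_of_unramified`), so no nonzero `q ∈ 𝔪_K` lies in `q^n · ℐ_K` for `n ≥ 2` — in
particular not in `q^{j²} · ℐ_K` for any label `j ≥ 2`. [cite: MochizukiAbsTopIII2015, Def 5.4 (iii) p. 126] -/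
theorem not_mem_pow_smul_logShell_of_unramified (hp : p ≠ 2) (he : absRamificationIdx p K = 1) {q : K} (hq0 : q ≠ 0) (hq1 : ‖q‖ < 1)
    {n : ℕ} (hn : 2 ≤ n) : q ∉ q ^ n • logShell (PadicLogOnUnits.ofUnitLog p K) := by
  rw [logShell_ofUnitLog_eq_closedBall_of_unramified p K hp he]
  exact not_mem_pow_smul_of_subset_closedBall_one subset_rfl hq0 hq1 hn

/-- The label form: for every `j ≥ 2`, `q ∉ q^{j²} · ℐ_K` at an absolutely unramified odd place. [cite: MochizukiAbsTopIII2015, Def 5.4 (iii) p. 126] -/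
theorem not_mem_jsq_smul_logShell_of_unramified (hp : p ≠ 2) (he : absRamificationIdx p K = 1) {q : K} (hq0 : q ≠ 0) (hq1 : ‖q‖ < 1)
    {j : ℕ} (hj : 2 ≤ j) : q ∉ q ^ (j ^ 2) • logShell (PadicLogOnUnits.ofUnitLog p K) :=
  not_mem_pow_smul_logShell_of_unramified p K hp he hq0 hq1 (le_trans (by norm_num) (Nat.pow_le_pow_left hj 2))

end Unramified

/-! ## 3. General ramification: the HEIGHT BOUND by the log-shell radius ([IUTchIV] Prop. 1.2 (i) upper inclusion) -/

section General

variable (p : ℕ) [Fact p.Prime]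
variable (K : Type*) [NontriviallyNormedField K] [NormedAlgebra ℚ_[p] K] [IsUltrametricDist K] [ProperSpace K]

/-- **The real log-shell lies in the ball of radius `‖p*‖⁻¹ · p^{b_e}`** (`ℐ_K = (p*)⁻¹·log_p(𝒪_K^×)` and abc-iut-S1's [IUTchIV] Prop. 1.2 (i)
upper inclusion `log_p(𝒪_K^×) ⊆ p^{−b}·𝒪_K`, `b = logRadiusB p e`). [cite: MochizukiAbsTopIII2015, Def 5.4 (iii) p. 126] -/
theorem logShell_ofUnitLog_subset_closedBall :
    logShell (PadicLogOnUnits.ofUnitLog p K) ⊆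
      closedBall (0 : K) (‖((p ^ (if p = 2 then 2 else 1) : ℕ) : K)‖⁻¹ * (p : ℝ) ^ logRadiusB p (absRamificationIdx p K)) := by
  rw [logShell_ofUnitLog]
  rintro _ ⟨y, hy, rfl⟩
  have hyb : ‖y‖ ≤ (p : ℝ) ^ logRadiusB p (absRamificationIdx p K) := by
    have := (mem_pBall_iff p K).1 (logUnits_subset_pBall_neg_logRadiusB p K hy)
    rwa [neg_neg] at this
  rw [mem_closedBall, dist_zero_right]
  show ‖((p ^ (if p = 2 then 2 else 1) : ℕ) : K)⁻¹ • y‖ ≤ _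
  rw [smul_eq_mul, norm_mul, norm_inv]
  exact mul_le_mul_of_nonneg_left hyb (inv_nonneg.2 (norm_nonneg _))

/-- **HEIGHT BOUND at a real place of arbitrary ramification**: if `q ∈ q^n · ℐ_K` then `‖q‖ ≤ ‖q‖^n · ‖p*‖⁻¹ · p^{b_e}` — with `‖q‖ = p^{−h}`:
`(n − 1)·h ≤ b_e + ord_p(p*)`, the local height of `q` is bounded by the log-shell's index, a quantity depending only on `p` and `e`.
For `n = j²` this is the arithmetic content of row RP-I06 at the place. [cite: MochizukiAbsTopIII2015, Def 5.4 (iii) p. 126] -/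
theorem norm_le_of_mem_pow_smul_logShell {q : K} {n : ℕ} (h : q ∈ q ^ n • logShell (PadicLogOnUnits.ofUnitLog p K)) :
    ‖q‖ ≤ ‖q‖ ^ n * (‖((p ^ (if p = 2 then 2 else 1) : ℕ) : K)‖⁻¹ * (p : ℝ) ^ logRadiusB p (absRamificationIdx p K)) :=
  norm_le_of_mem_pow_smul (logShell_ofUnitLog_subset_closedBall p K) h

end General

end Summit.ABC.IUTFork.Repair.CandInternal2Real

end
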